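import Summits.HodgeConjecture.HodgeConjecture.Cruxes.BlochSeedDiscOne.DeepLayerLaws

/-!
# RING-3 ANATOMY — the class-type room of record at ring 3 is the SUM RULE at `c = 3` (kernel, every height)

Strengthen g17 for director-hodge R19.679 (C)(i)(ii) (ring 3 is the front).  A standalone companion of `DeepLayerLaws.lean` (§13 of its v1.8 text;
filed separately because the parent file reached the 200 kB crux-write cap; imports `DeepLayerLaws` and uses only its §1∕§6∕§6c, present in every
tree version ≥ v1.2).

On a design with `OnAlphabet η ∧ Disj ∧ RuleD ∧ RingLe 3` (EVERY height `η`; NO (A1), NO Hall, μ only in the last theorem) the letters of a supported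
cell fall in five kinds by co-level: hub `H` (0), unit `u` (1), mid axis `A` (2, `x·y = 0`), mid diagonal `B` (2, `x·y ≠ 0`), DEEP `F` (3: `C` axis ∕
`D` off-axis — the anatomy does not see the difference; the e-free and charge rows of a type LP do).  Counts `nH nU nA nB nF : Cell → ℕ`.
SLOT LAWS = `DeepLayerLaws` §6c (THE SUM RULE) at `c = 3`: N — no two deep letters (`r3N_no_two_deep`); deep + mid ⇒ the other two are hubs
(`r3N_deep_mid_hub`); deep + unit ⇒ the other two have co-level ≤ 1 (`r3N_deep_unit_low`); two mids ⇒ the other two are axis of co-level ≤ 2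
(`r3N_two_mid`), so a mid `B` next to another mid forces the rest to co-level ≤ 1 (`r3N_mid_B_low`); P — no three deep (`r3P_no_three_deep`); two
deep ⇒ two hubs (`r3P_two_deep_hub`); deep + mid ⇒ the other two axis of co-level ≤ 2 (`r3P_deep_mid_axis`); deep + `B` ⇒ the other two have
co-level ≤ 1 (`r3P_deep_B_low`).
COUNT FORM (`n_partition3`: the five counts sum to 4; `nA_add_nB`): N — `nF ≤ 1`; deep ⇒ `nA + nB ≤ 1`; deep + mid ⇒ `nH = 2`; a `B` ⇒ `nA + nB ≤ 2`
(`anatomyN_ring3`) = gs-eng-2 g64's LAW F₃ N-room «`#F ≤ 1`; `#F = 1 ⇒ rest ∈ {HHH, HHu, Huu, uuu, AHH, BHH}`; `#F = 0 ⇒ #B = 0 or #A + #B ≤ 2`»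
(37 class types; room of record hsem-4 `room3.json` a056d4353f7c8789, ×3: hsem-4, this seat's `eng∕sumroom.py` N 22 913 ∕ P 78 817, gs-eng-2);
P — `nF ≤ 2`; `nF = 2 ⇒ nH = 2`; deep ⇒ `nB ≤ 1`; deep + `B` ⇒ `nA = 0` (`anatomyP_ring3`) = LAW F₃'s P-room (64 class types).
CHARGED CELLS (`nH = 0`, the μ-carrier candidates of (C)(ii)): `charged_N_ring3` — deep ⇒ `Fuuu`; a `B` ⇒ no deep letter and ≥ 2 units; with the
partition exactly the ten class types u⁴, Auuu, Buuu, Cuuu, Duuu, AAuu, ABuu, BBuu, AAAu, AAAA; `charged_P_ring3` — `nF ≤ 1`; deep ⇒ `nB ≤ 1`, deep +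
`B` ⇒ no `A`: the 25 H-free P-types; `mu_carrier_ring3`: `μ ≠ 0` ⇒ a supported fully charged cell of one of these types exists
(`DeepLayerLaws.exists_full_of_mu_ne`).
HONEST LABEL.  SOUNDNESS ONLY: every supported cell has an admissible class type; that all these types are INHABITED by the gfp room is the machine
digit ×3, not claimed in the kernel.  Letter designs ≠ displays ≠ sheaves ≠ SEED; census-neutral; nothing here is proved toward HC ∕ HC_CM ∕ HC_AV ∕
№4 ∕ 26512 ∕ 18881 ∕ H2; no S⁺ registered.  No `sorry`, `axiom`, `instance`, `notation`, `native_decide`, unsafe option.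
(planner `plan-lens-HodgeAV-strengthen` g17, lens «strengthen», 2026-08-31; crux `BlochSeedDiscOne` = item `stmt-HodgeConjecture-18881`)

line stmt-HodgeConjecture-18881 Cruxes/BlochSeedDiscOne/Lines/birth.lean 814a6a70c14e831a stub_rung_pad4_seedAt
-/

set_option linter.dupNamespace false
set_option autoImplicit false

namespace Summit.HodgeConjecture.HodgeConjecture.Cruxes.BlochSeedDiscOne.RingThreeAnatomy

open Summit.HodgeConjecture.HodgeConjecture.Cruxes.BlochSeedDiscOne.DepthBoundA4
open Summit.HodgeConjecture.HodgeConjecture.Cruxes.BlochSeedDiscOne.LeggedFloor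
  (NullStep Supplies Detects RuleDP RuleD Disj FullBelow mem_supp_of_memP mem_supp_of_memN)
open Summit.HodgeConjecture.HodgeConjecture.Cruxes.BlochSeedDiscOne.DeepLayerLaws
  (RingLe colevel_nonneg colevel_hub ring_top_unique_N sum_rule_N_hub sum_rule_N_axis sum_rule_P_three sum_rule_P_hub sum_rule_P_axis
    exists_full_of_mu_ne one_le_colevel_of_full)



variable {η : ℤ} {D : Design}

/-- letter-kind counts of a cell on ring 3: hubs (co-level 0), units (1), mid axis `A` (2, `x·y = 0`), mid diagonal `B` (2, `x·y ≠ 0`), deep (3). -/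
def nH (c : Cell) : ℕ := (Finset.univ.filter fun f : Fin 4 => (c f).colevel = 0).card
def nU (c : Cell) : ℕ := (Finset.univ.filter fun f : Fin 4 => (c f).colevel = 1).card
def nA (c : Cell) : ℕ := (Finset.univ.filter fun f : Fin 4 => (c f).colevel = 2 ∧ (c f).x * (c f).y = 0).card

def nF (c : Cell) : ℕ := (Finset.univ.filter fun f : Fin 4 => (c f).colevel = 3).card
def nB (c : Cell) : ℕ := (Finset.univ.filter fun f : Fin 4 => (c f).colevel = 2 ∧ (c f).x * (c f).y ≠ 0).card

/-! ### finite-set bookkeeping on `Fin 4` -/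

theorem card_filter_le_one_of {P : Fin 4 → Prop} [DecidablePred P] (h : ∀ a b, P a → P b → a = b) :
    (Finset.univ.filter P).card ≤ 1 :=
  Finset.card_le_one.mpr fun a ha b hb => h a b (Finset.mem_filter.mp ha).2 (Finset.mem_filter.mp hb).2

theorem exists_of_one_le_card {P : Fin 4 → Prop} [DecidablePred P] (h : 1 ≤ (Finset.univ.filter P).card) : ∃ a, P a := by
  obtain ⟨a, ha⟩ := Finset.card_pos.mp h
  exact ⟨a, (Finset.mem_filter.mp ha).2⟩

theorem exists_two_of_two_le_card {P : Fin 4 → Prop} [DecidablePred P] (h : 2 ≤ (Finset.univ.filter P).card) :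
    ∃ a b, a ≠ b ∧ P a ∧ P b := by
  obtain ⟨a, ha, b, hb, hab⟩ := Finset.one_lt_card.mp h
  exact ⟨a, b, hab, (Finset.mem_filter.mp ha).2, (Finset.mem_filter.mp hb).2⟩

theorem exists_three_of_three_le_card {P : Fin 4 → Prop} [DecidablePred P] (h : 3 ≤ (Finset.univ.filter P).card) :
    ∃ a b c, a ≠ b ∧ a ≠ c ∧ b ≠ c ∧ P a ∧ P b ∧ P c := by
  obtain ⟨a, ha, b, hb, c, hc, hab, hac, hbc⟩ := Finset.two_lt_card.mp h
  exact ⟨a, b, c, hab, hac, hbc, (Finset.mem_filter.mp ha).2, (Finset.mem_filter.mp hb).2, (Finset.mem_filter.mp hc).2⟩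

theorem card_compl_pair {g j : Fin 4} (hgj : g ≠ j) : (Finset.univ.filter fun f : Fin 4 => f ≠ g ∧ f ≠ j).card = 2 := by
  have e : (Finset.univ.filter fun f : Fin 4 => f ≠ g ∧ f ≠ j) = (Finset.univ.erase g).erase j := by
    ext f
    simp only [Finset.mem_filter, Finset.mem_univ, true_and, Finset.mem_erase]
    tauto
  rw [e, Finset.card_erase_of_mem (Finset.mem_erase.mpr ⟨hgj.symm, Finset.mem_univ _⟩),
    Finset.card_erase_of_mem (Finset.mem_univ _), Finset.card_univ, Fintype.card_fin]

theorem card_filter_eq_two_of_iff {P : Fin 4 → Prop} [DecidablePred P] {g j : Fin 4} (hgj : g ≠ j)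
    (h : ∀ f, P f ↔ (f ≠ g ∧ f ≠ j)) : (Finset.univ.filter P).card = 2 := by
  rw [Finset.filter_congr (fun f _ => h f)]
  exact card_compl_pair hgj

/-- the axis ∕ diagonal split of the mid letters. -/
theorem cntA_add_cntBm (c : Cell) :
    nA c + nB c = (Finset.univ.filter fun f : Fin 4 => (c f).colevel = 2).card := by
  unfold nA nB
  simp only [Finset.card_filter]
  rw [← Finset.sum_add_distrib]
  refine Finset.sum_congr rfl fun f _ => ?_
  by_cases h2 : (c f).colevel = 2 <;> by_cases hax : (c f).x * (c f).y = 0 <;> simp [h2, hax]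

/-- on ring 3 every slot is a hub, a unit, a mid axis, a mid diagonal or a deep letter: the five counts sum to 4. -/
theorem n_partition3 {c : Cell} (h3 : ∀ f : Fin 4, (c f).colevel ≤ 3) :
    nH c + nU c + nA c + nB c + nF c = 4 := by
  unfold nH nU nA nB nF
  simp only [Finset.card_filter]
  rw [← Finset.sum_add_distrib, ← Finset.sum_add_distrib, ← Finset.sum_add_distrib, ← Finset.sum_add_distrib]
  rw [Finset.sum_eq_card_nsmul (b := 1) ?_]
  · simp
  · intro f _
    have h0 := colevel_nonneg (c f)
    have hf := h3 f
    rcases (show (c f).colevel = 0 ∨ (c f).colevel = 1 ∨ (c f).colevel = 2 ∨ (c f).colevel = 3 by omega) with h | h | h | h <;>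
      by_cases hax : (c f).x * (c f).y = 0 <;> simp [h, hax]

theorem ring3_le (hR : RingLe 3 D) {c : Cell} (hc : c ∈ D.suppN ++ D.suppP) (f : Fin 4) : (c f).colevel ≤ 3 := hR c hc f

/-! ### slot laws, N side -/

theorem r3N_no_two_deep (hA : D.OnAlphabet η) (hdis : Disj D) (hr : RuleD D) (hR : RingLe 3 D) {y : Cell} (hy : y ∈ D.suppN)
    {g j : Fin 4} (hgj : g ≠ j) (hg : (y g).colevel = 3) (hj : (y j).colevel = 3) : False :=
  ring_top_unique_N hA hdis hr hR (by norm_num) hy hgj hg hj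

theorem r3N_deep_mid_hub (hA : D.OnAlphabet η) (hdis : Disj D) (hr : RuleD D) (hR : RingLe 3 D) {y : Cell} (hy : y ∈ D.suppN)
    {g j s : Fin 4} (hgj : g ≠ j) (hsg : s ≠ g) (hsj : s ≠ j) (hg : (y g).colevel = 3) (hj : (y j).colevel = 2) :
    y s = Letter.hub η :=
  sum_rule_N_hub hA hdis hr hR (by norm_num) hy hgj hsg hsj (by rw [hg, hj]; norm_num)

theorem r3N_deep_unit_low (hA : D.OnAlphabet η) (hdis : Disj D) (hr : RuleD D) (hR : RingLe 3 D) {y : Cell} (hy : y ∈ D.suppN)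
    {g j s : Fin 4} (hgj : g ≠ j) (hsg : s ≠ g) (hsj : s ≠ j) (hg : (y g).colevel = 3) (hj : (y j).colevel = 1) :
    (y s).colevel ≤ 1 := by
  have h3 := ring3_le hR (mem_supp_of_memN D hy) s
  rcases (show (y s).colevel ≤ 1 ∨ (y s).colevel = 2 ∨ (y s).colevel = 3 by omega) with h | h | h
  · exact h
  · have e := r3N_deep_mid_hub hA hdis hr hR hy hsg.symm hgj.symm hsj.symm hg h
    rw [e, colevel_hub] at hj
    omega
  · exact (r3N_no_two_deep hA hdis hr hR hy hsg h hg).elim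

theorem r3N_two_mid (hA : D.OnAlphabet η) (hdis : Disj D) (hr : RuleD D) (hR : RingLe 3 D) {y : Cell} (hy : y ∈ D.suppN)
    {g j s : Fin 4} (hgj : g ≠ j) (hsg : s ≠ g) (hsj : s ≠ j) (hg : (y g).colevel = 2) (hj : (y j).colevel = 2) :
    (y s).x * (y s).y = 0 ∧ (y s).colevel ≤ 2 := by
  refine ⟨sum_rule_N_axis hA hdis hr hR (by norm_num) hy hgj hsg hsj (by rw [hg, hj]; norm_num), ?_⟩
  have h3 := ring3_le hR (mem_supp_of_memN D hy) s
  by_contra hlt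
  have hs : (y s).colevel = 3 := by omega
  have e := r3N_deep_mid_hub hA hdis hr hR hy hsg hsj.symm hgj.symm hs hg
  rw [e, colevel_hub] at hj
  omega

/-- a mid diagonal `B` next to another mid letter forces the remaining two slots to co-level `≤ 1`. -/
theorem r3N_mid_B_low (hA : D.OnAlphabet η) (hdis : Disj D) (hr : RuleD D) (hR : RingLe 3 D) {y : Cell} (hy : y ∈ D.suppN)
    {g j s : Fin 4} (hgj : g ≠ j) (hsg : s ≠ g) (hsj : s ≠ j) (hg : (y g).colevel = 2) (hj : (y j).colevel = 2)
    (hB : (y j).x * (y j).y ≠ 0) : (y s).colevel ≤ 1 := by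
  obtain ⟨-, h2⟩ := r3N_two_mid hA hdis hr hR hy hgj hsg hsj hg hj
  by_contra hlt
  have hs : (y s).colevel = 2 := by omega
  exact hB (r3N_two_mid hA hdis hr hR hy hsg.symm hgj.symm hsj.symm hg hs).1

/-! ### slot laws, P side -/

theorem r3P_no_three_deep (hA : D.OnAlphabet η) (hdis : Disj D) (hr : RuleD D) (hR : RingLe 3 D) {x : Cell} (hx : x ∈ D.suppP)
    {g₁ g₂ g₃ : Fin 4} (h12 : g₁ ≠ g₂) (h13 : g₁ ≠ g₃) (h23 : g₂ ≠ g₃)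
    (ht1 : (x g₁).colevel = 3) (ht2 : (x g₂).colevel = 3) (ht3 : (x g₃).colevel = 3) : False :=
  sum_rule_P_three hA hdis hr hR (by norm_num) hx h12 h13 h23 ht1 ht2 ht3

theorem r3P_two_deep_hub (hA : D.OnAlphabet η) (hdis : Disj D) (hr : RuleD D) (hR : RingLe 3 D) {x : Cell} (hx : x ∈ D.suppP)
    {g j s : Fin 4} (hgj : g ≠ j) (hsg : s ≠ g) (hsj : s ≠ j) (hg : (x g).colevel = 3) (hj : (x j).colevel = 3) :
    x s = Letter.hub η :=
  sum_rule_P_hub hA hdis hr hR (by norm_num) hx hgj hsg hsj (by rw [hg, hj]; norm_num)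

theorem r3P_deep_mid_axis (hA : D.OnAlphabet η) (hdis : Disj D) (hr : RuleD D) (hR : RingLe 3 D) {x : Cell} (hx : x ∈ D.suppP)
    {g j s : Fin 4} (hgj : g ≠ j) (hsg : s ≠ g) (hsj : s ≠ j) (hg : (x g).colevel = 3) (hj : (x j).colevel = 2) :
    (x s).x * (x s).y = 0 ∧ (x s).colevel ≤ 2 := by
  refine ⟨sum_rule_P_axis hA hdis hr hR (by norm_num) hx hgj hsg hsj (by rw [hg, hj]; norm_num), ?_⟩
  have h3 := ring3_le hR (mem_supp_of_memP D hx) s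
  by_contra hlt
  have hs : (x s).colevel = 3 := by omega
  have e := r3P_two_deep_hub hA hdis hr hR hx hsg.symm hgj.symm hsj.symm hg hs
  rw [e, colevel_hub] at hj
  omega

/-- deep + mid diagonal `B` on a P-cell: the remaining two slots have co-level `≤ 1` (no `A`, no second `B`). -/
theorem r3P_deep_B_low (hA : D.OnAlphabet η) (hdis : Disj D) (hr : RuleD D) (hR : RingLe 3 D) {x : Cell} (hx : x ∈ D.suppP)
    {g j s : Fin 4} (hgj : g ≠ j) (hsg : s ≠ g) (hsj : s ≠ j) (hg : (x g).colevel = 3) (hj : (x j).colevel = 2)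
    (hB : (x j).x * (x j).y ≠ 0) : (x s).colevel ≤ 1 := by
  obtain ⟨-, h2⟩ := r3P_deep_mid_axis hA hdis hr hR hx hgj hsg hsj hg hj
  by_contra hlt
  have hs : (x s).colevel = 2 := by omega
  exact hB (r3P_deep_mid_axis hA hdis hr hR hx hsg.symm hgj.symm hsj.symm hg hs).1

/-! ### count form, N side (LAW F₃ N-room) -/

theorem cnt3_N_le_one (hA : D.OnAlphabet η) (hdis : Disj D) (hr : RuleD D) (hR : RingLe 3 D) {y : Cell} (hy : y ∈ D.suppN) :
    nF y ≤ 1 :=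
  card_filter_le_one_of fun a b ha hb => by
    by_contra hab
    exact r3N_no_two_deep hA hdis hr hR hy hab ha hb

theorem mid_N_le_one_of_deep (hA : D.OnAlphabet η) (hdis : Disj D) (hr : RuleD D) (hR : RingLe 3 D) {y : Cell} (hy : y ∈ D.suppN)
    {g : Fin 4} (hg : (y g).colevel = 3) : nA y + nB y ≤ 1 := by
  rw [cntA_add_cntBm]
  exact card_filter_le_one_of fun a b ha hb => by
    by_contra hab
    have hag : g ≠ a := fun e => by rw [e] at hg; omega
    have hbg : b ≠ g := fun e => by rw [e] at hb; omega
    have e := r3N_deep_mid_hub hA hdis hr hR hy hag hbg (fun e => hab e.symm) hg ha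
    rw [e, colevel_hub] at hb
    omega

theorem mid_N_le_one_of_cnt3 (hA : D.OnAlphabet η) (hdis : Disj D) (hr : RuleD D) (hR : RingLe 3 D) {y : Cell} (hy : y ∈ D.suppN)
    (h3 : 1 ≤ nF y) : nA y + nB y ≤ 1 := by
  obtain ⟨g, hg⟩ := exists_of_one_le_card h3
  exact mid_N_le_one_of_deep hA hdis hr hR hy hg

theorem cntH_N_eq_two_of_deep_mid (hA : D.OnAlphabet η) (hdis : Disj D) (hr : RuleD D) (hR : RingLe 3 D) {y : Cell} (hy : y ∈ D.suppN)
    {g j : Fin 4} (hgj : g ≠ j) (hg : (y g).colevel = 3) (hj : (y j).colevel = 2) : nH y = 2 :=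
  card_filter_eq_two_of_iff hgj fun f =>
    ⟨fun h0 => ⟨fun e => by rw [e] at h0; omega, fun e => by rw [e] at h0; omega⟩,
     fun hf => by rw [r3N_deep_mid_hub hA hdis hr hR hy hgj hf.1 hf.2 hg hj, colevel_hub]⟩

theorem cntH_N_eq_two_of_cnt (hA : D.OnAlphabet η) (hdis : Disj D) (hr : RuleD D) (hR : RingLe 3 D) {y : Cell} (hy : y ∈ D.suppN)
    (h3 : 1 ≤ nF y) (hm : 1 ≤ nA y + nB y) : nH y = 2 := by
  obtain ⟨g, hg⟩ := exists_of_one_le_card h3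
  rw [cntA_add_cntBm] at hm
  obtain ⟨j, hj⟩ := exists_of_one_le_card hm
  have hgj : g ≠ j := fun e => by rw [e] at hg; omega
  exact cntH_N_eq_two_of_deep_mid hA hdis hr hR hy hgj hg hj

theorem mid_N_le_two_of_B (hA : D.OnAlphabet η) (hdis : Disj D) (hr : RuleD D) (hR : RingLe 3 D) {y : Cell} (hy : y ∈ D.suppN)
    {j : Fin 4} (hj : (y j).colevel = 2) (hB : (y j).x * (y j).y ≠ 0) : nA y + nB y ≤ 2 := by
  rw [cntA_add_cntBm]
  set s := Finset.univ.filter fun f : Fin 4 => (y f).colevel = 2 with hs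
  have hjs : j ∈ s := Finset.mem_filter.mpr ⟨Finset.mem_univ _, hj⟩
  have h1 : (s.erase j).card ≤ 1 := by
    refine Finset.card_le_one.mpr fun a ha b hb => ?_
    obtain ⟨haj, ha⟩ := Finset.mem_erase.mp ha
    obtain ⟨hbj, hb⟩ := Finset.mem_erase.mp hb
    have ha2 := (Finset.mem_filter.mp ha).2
    have hb2 := (Finset.mem_filter.mp hb).2
    by_contra hab
    have := r3N_mid_B_low hA hdis hr hR hy haj (fun e => hab e.symm) hbj ha2 hj hB
    omega
  have := Finset.card_erase_add_one hjs
  omega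

theorem mid_N_le_two_of_cntBm (hA : D.OnAlphabet η) (hdis : Disj D) (hr : RuleD D) (hR : RingLe 3 D) {y : Cell} (hy : y ∈ D.suppN)
    (hb : 1 ≤ nB y) : nA y + nB y ≤ 2 := by
  obtain ⟨j, hj, hB⟩ := exists_of_one_le_card hb
  exact mid_N_le_two_of_B hA hdis hr hR hy hj hB

/-! ### count form, P side (LAW F₃ P-room) -/

theorem cnt3_P_le_two (hA : D.OnAlphabet η) (hdis : Disj D) (hr : RuleD D) (hR : RingLe 3 D) {x : Cell} (hx : x ∈ D.suppP) :
    nF x ≤ 2 := by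
  by_contra h
  unfold nF at h
  obtain ⟨a, b, c, hab, hac, hbc, ha, hb, hc⟩ := exists_three_of_three_le_card (P := fun f => (x f).colevel = 3) (by omega)
  exact r3P_no_three_deep hA hdis hr hR hx hab hac hbc ha hb hc

theorem cntH_P_eq_two_of_two_deep (hA : D.OnAlphabet η) (hdis : Disj D) (hr : RuleD D) (hR : RingLe 3 D) {x : Cell} (hx : x ∈ D.suppP)
    {g j : Fin 4} (hgj : g ≠ j) (hg : (x g).colevel = 3) (hj : (x j).colevel = 3) : nH x = 2 :=
  card_filter_eq_two_of_iff hgj fun f =>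
    ⟨fun h0 => ⟨fun e => by rw [e] at h0; omega, fun e => by rw [e] at h0; omega⟩,
     fun hf => by rw [r3P_two_deep_hub hA hdis hr hR hx hgj hf.1 hf.2 hg hj, colevel_hub]⟩

theorem cntH_P_eq_two_of_cnt3 (hA : D.OnAlphabet η) (hdis : Disj D) (hr : RuleD D) (hR : RingLe 3 D) {x : Cell} (hx : x ∈ D.suppP)
    (h3 : 2 ≤ nF x) : nH x = 2 := by
  obtain ⟨g, j, hgj, hg, hj⟩ := exists_two_of_two_le_card h3
  exact cntH_P_eq_two_of_two_deep hA hdis hr hR hx hgj hg hj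

theorem cntBm_P_le_one_of_deep (hA : D.OnAlphabet η) (hdis : Disj D) (hr : RuleD D) (hR : RingLe 3 D) {x : Cell} (hx : x ∈ D.suppP)
    {g : Fin 4} (hg : (x g).colevel = 3) : nB x ≤ 1 :=
  card_filter_le_one_of fun a b ha hb => by
    by_contra hab
    have hag : g ≠ a := fun e => by rw [e] at hg; omega
    have hbg : b ≠ g := fun e => by rw [e] at hb; omega
    have := r3P_deep_B_low hA hdis hr hR hx hag hbg (fun e => hab e.symm) hg ha.1 ha.2
    omega

theorem cntBm_P_le_one_of_cnt3 (hA : D.OnAlphabet η) (hdis : Disj D) (hr : RuleD D) (hR : RingLe 3 D) {x : Cell} (hx : x ∈ D.suppP)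
    (h3 : 1 ≤ nF x) : nB x ≤ 1 := by
  obtain ⟨g, hg⟩ := exists_of_one_le_card h3
  exact cntBm_P_le_one_of_deep hA hdis hr hR hx hg

theorem cntA_P_eq_zero_of_deep_B (hA : D.OnAlphabet η) (hdis : Disj D) (hr : RuleD D) (hR : RingLe 3 D) {x : Cell} (hx : x ∈ D.suppP)
    {g j : Fin 4} (hg : (x g).colevel = 3) (hj : (x j).colevel = 2) (hB : (x j).x * (x j).y ≠ 0) : nA x = 0 := by
  unfold nA
  rw [Finset.card_eq_zero, Finset.filter_eq_empty_iff]
  intro s _ hs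
  have hsg : s ≠ g := fun e => by rw [e] at hs; omega
  have hsj : s ≠ j := fun e => by rw [e] at hs; exact hB hs.2
  have hgj : g ≠ j := fun e => by rw [e] at hg; omega
  have := r3P_deep_B_low hA hdis hr hR hx hgj hsg hsj hg hj hB
  omega

theorem cntA_P_eq_zero_of_cnt (hA : D.OnAlphabet η) (hdis : Disj D) (hr : RuleD D) (hR : RingLe 3 D) {x : Cell} (hx : x ∈ D.suppP)
    (h3 : 1 ≤ nF x) (hb : 1 ≤ nB x) : nA x = 0 := by
  obtain ⟨g, hg⟩ := exists_of_one_le_card h3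
  obtain ⟨j, hj, hB⟩ := exists_of_one_le_card hb
  exact cntA_P_eq_zero_of_deep_B hA hdis hr hR hx hg hj hB

/-! ### the anatomy packaged, and the charged (μ-carrier candidate) cells -/

/-- **LAW F₃, N side (kernel, every height).** -/
theorem anatomyN_ring3 (hA : D.OnAlphabet η) (hdis : Disj D) (hr : RuleD D) (hR : RingLe 3 D) {y : Cell} (hy : y ∈ D.suppN) :
    nF y ≤ 1 ∧ (1 ≤ nF y → nA y + nB y ≤ 1) ∧ (1 ≤ nF y → 1 ≤ nA y + nB y → nH y = 2) ∧
      (1 ≤ nB y → nA y + nB y ≤ 2) ∧ nH y + nU y + nA y + nB y + nF y = 4 :=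
  ⟨cnt3_N_le_one hA hdis hr hR hy, mid_N_le_one_of_cnt3 hA hdis hr hR hy, cntH_N_eq_two_of_cnt hA hdis hr hR hy,
    mid_N_le_two_of_cntBm hA hdis hr hR hy, n_partition3 (ring3_le hR (mem_supp_of_memN D hy))⟩

/-- **LAW F₃, P side (kernel, every height).** -/
theorem anatomyP_ring3 (hA : D.OnAlphabet η) (hdis : Disj D) (hr : RuleD D) (hR : RingLe 3 D) {x : Cell} (hx : x ∈ D.suppP) :
    nF x ≤ 2 ∧ (2 ≤ nF x → nH x = 2) ∧ (1 ≤ nF x → nB x ≤ 1) ∧ (1 ≤ nF x → 1 ≤ nB x → nA x = 0) ∧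
      nH x + nU x + nA x + nB x + nF x = 4 :=
  ⟨cnt3_P_le_two hA hdis hr hR hx, cntH_P_eq_two_of_cnt3 hA hdis hr hR hx, cntBm_P_le_one_of_cnt3 hA hdis hr hR hx,
    cntA_P_eq_zero_of_cnt hA hdis hr hR hx, n_partition3 (ring3_le hR (mem_supp_of_memP D hx))⟩

/-- **charged N-cells on ring 3** (`nH = 0`): a deep letter comes with three units (`Cuuu ∕ Duuu`), a mid diagonal `B` with at least two units
(`Buuu, ABuu, BBuu`); otherwise the letters are units and mid axis `A` (`u⁴, Auuu, AAuu, AAAu, AAAA`) — ten class types. -/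
theorem charged_N_ring3 (hA : D.OnAlphabet η) (hdis : Disj D) (hr : RuleD D) (hR : RingLe 3 D) {y : Cell} (hy : y ∈ D.suppN)
    (hH : nH y = 0) :
    nF y ≤ 1 ∧ (nF y = 1 → nU y = 3) ∧ (1 ≤ nB y → nF y = 0 ∧ 2 ≤ nU y) ∧
      nU y + nA y + nB y + nF y = 4 := by
  obtain ⟨h1, h2, h3, h4, hp⟩ := anatomyN_ring3 hA hdis hr hR hy
  refine ⟨h1, fun h31 => ?_, fun hb => ?_, by omega⟩
  · have hm : nA y + nB y = 0 := by
      by_contra hne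
      have := h3 (by omega) (by omega)
      omega
    omega
  · have hm2 := h4 hb
    have h30 : nF y = 0 := by
      by_contra hne
      have := h3 (by omega) (by omega)
      omega
    exact ⟨h30, by omega⟩

/-- **charged P-cells on ring 3** (`nH = 0`): at most one deep letter; with a deep letter at most one `B` and then no `A` — the 25 H-free types. -/
theorem charged_P_ring3 (hA : D.OnAlphabet η) (hdis : Disj D) (hr : RuleD D) (hR : RingLe 3 D) {x : Cell} (hx : x ∈ D.suppP)
    (hH : nH x = 0) :
    nF x ≤ 1 ∧ (nF x = 1 → nB x ≤ 1 ∧ (1 ≤ nB x → nA x = 0)) ∧ nU x + nA x + nB x + nF x = 4 := by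
  obtain ⟨h1, h2, h3, h4, hp⟩ := anatomyP_ring3 hA hdis hr hR hx
  refine ⟨?_, fun h31 => ⟨h3 (by omega), fun hb => h4 (by omega) hb⟩, by omega⟩
  by_contra hne
  have := h2 (by omega)
  omega

theorem cntH_eq_zero_of_full {c : Cell} (hc : ∀ f : Fin 4, (c f).OnAlphabet η) (hfull : FullBelow η c) : nH c = 0 := by
  unfold nH
  rw [Finset.card_eq_zero, Finset.filter_eq_empty_iff]
  intro f _ h0
  have := one_le_colevel_of_full hc hfull f
  omega

/-- **μ-CARRIER LAW on ring 3** (director R19.679 (C)(ii)): `μ ≠ 0` ⇒ some supported cell is fully charged (`exists_full_of_mu_ne`, the only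
place μ enters), and its class type is one of the ten charged N-types or the 25 charged P-types of LAW F₃. -/
theorem mu_carrier_ring3 (hA : D.OnAlphabet η) (hdis : Disj D) (hr : RuleD D) (hR : RingLe 3 D) (hμ : D.mu ≠ 0) :
    (∃ y ∈ D.suppN, nH y = 0 ∧ nF y ≤ 1 ∧ (nF y = 1 → nU y = 3) ∧ (1 ≤ nB y → nF y = 0 ∧ 2 ≤ nU y) ∧
        nU y + nA y + nB y + nF y = 4) ∨
      (∃ x ∈ D.suppP, nH x = 0 ∧ nF x ≤ 1 ∧ (nF x = 1 → nB x ≤ 1 ∧ (1 ≤ nB x → nA x = 0)) ∧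
        nU x + nA x + nB x + nF x = 4) := by
  obtain ⟨c, hc, hfull⟩ := exists_full_of_mu_ne D hA hμ
  have hH := cntH_eq_zero_of_full (hA c hc) hfull
  rcases List.mem_append.mp hc with hN | hP
  · exact Or.inl ⟨c, hN, hH, charged_N_ring3 hA hdis hr hR hN hH⟩
  · exact Or.inr ⟨c, hP, hH, charged_P_ring3 hA hdis hr hR hP hH⟩

end Summit.HodgeConjecture.HodgeConjecture.Cruxes.BlochSeedDiscOne.RingThreeAnatomy
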